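import Summits.ResolutionOfSingularities.ResolutionOfSingularities.Theorems.PurelyInseparableDim4SwapTransportWindowCoreAnyPrime
import Summits.ResolutionOfSingularities.ResolutionOfSingularities.Theorems.PurelyInseparableDim4SwapTransportWindowResidualPrime
import Summits.ResolutionOfSingularities.ResolutionOfSingularities.Theorems.PurelyInseparableDim4ResConeCInfSharpLookAheadPrime
import Summits.ResolutionOfSingularities.ResolutionOfSingularities.Theorems.PurelyInseparableDim4ResConeCInfPinningPrime
import HarnessLib
import HarnessLib.Audit.Tags

/-!
# Purely inseparable four-folds — THE UNPINNED VIRTUAL CHAIN, EVERY PRIME: a real light-pair chain in regime is shadowed by a chain of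
# TRANSLATED virtual slot steps `x_u ↦ x_u + β_t x_ℓ` carrying the straight exact-ledger frame, and a real SATELLITE step is a virtual
# LETTER CHANGE (cell `res-dim4-pi`, K2(p) lane, rung-1 POWER-CONE LINE «light pair of TAIL(p, p−1, 3) ∀ p», flagless branch, ENTRY♯
# transport pieces (I♭) + (ℓ-sat) of res-dim4-p-3 g6's by-signature list; seat res-dim4-typ-1 g6)

[OURS · counted 0 · cell `res-dim4-pi` · K2(p) lane (holder res-dim4-p-12 g5, ruling 14:57Z «(γ) first»); res-dim4-p-3 g6's by-signature list (bus
2026-08-29 14:56Z).]  Nothing here proves K2(p) for any `p`, any TAIL(p, p−1, 3), FLAGLESS♯, `NoIsolatedTrap p p` or resolution of singularities in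
dimension ≥ 4 / characteristic `p` — NOT proved.  AI kernel work, weaker than expert review.  Transport bookkeeping about OUR frame; kills nothing.

* §1 **`πs_succ_apply_ℓs`**, **`virtual_letter_change_of_satellite`** ((ℓ-sat)) — along W5a's recursion data `(πs, ℓs)` the new bijection
  sends the virtual chart to the real one, `πs (t+1) (ℓs t) = j (k+t)`; hence a real SATELLITE step at `k + t` (`j (k+t+1) ≠ j (k+t)`,
  `b (k+t+1) (j (k+t)) = 0`) makes the NEXT virtual chart differ, `ℓs (t+1) ≠ ℓs t`, provided a real rotation translates one slot
  (`hone`, which G1 `step_cases_of_weights_prime` supplies in regime: `virtual_letter_change_of_satellite_of_regime`).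
* §2 **`exists_virtual_translated_chain_prime`** ((I♭)) — from a relation `(π₀, c k, B₀)` at precision `M` with `B₀` framed (order `d + 2`,
  `r = x_λx_μ ∣ F`, `resForm = a·x_f^d` + support dress, exact ledger, isolated, `e_G = 3`) and the real chain in regime up to `k + T + 1`
  (isolated with common certificate `Nc`, order `d + 2`, `e_G = 3`, weights `≤ 1` of degree `2`, `x^r ∣`), `Nc + 2p + 2 + p·T ≤ M`: there are
  `πs, Bs, ℓs, βs` with `πs 0 = π₀`, `Bs 0 = B₀`, W5a's formulas for `ℓs`, `πs` at EVERY `t`, the TRANSLATED steps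
  `Bs (t+1) = step p univ (ℓs t) (update 0 u (βs t)) (Bs t)` for `t ≤ T`, and at every `t ≤ T + 1` the relation at precision `M − p·t`, the
  real weights along `πs t`, and the frame of `Bs t` — C♯ `virtual_core_any_prime` per step, W2 (VT-f) `cInf_translation_contact_eq_zero_prime`
  for the contact component, TS `translated_child_frame_prime` for the child's frame; the sequences are built by extend-and-update induction.
[cite: Hauser2010, §§F–G] [cite: CossartJannsenSaito2020, Thm. 3.14]
bears_on: LADDER-RESOLUTION:D157-DOOR2 (res-dim4-pi · K2(p) · power cones · flagless branch ENTRY♯ transport (I♭)/(ℓ-sat)).  Supports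
stmt-ResolutionOfSingularities-16155 (helper).
-/

set_option linter.dupNamespace false -- mandated namespace of this single-conjunct summit

noncomputable section

namespace Summit.ResolutionOfSingularities.ResolutionOfSingularities.Theorems.PIDim4

namespace SwapTransport

open MvPolynomial Finset
open Literature.AlgebraicGeometry.Resolution
open Literature.AlgebraicGeometry.Resolution.CentreBlowup
open Literature.AlgebraicGeometry.Resolution.Hauser2010
open Literature.AlgebraicGeometry.Resolution.HauserPerlega2019

variable {K : Type} [Field K] [DecidableEq K]

/-! ## §1 A real satellite step is a virtual letter change -/

/-- **The new bijection sends the virtual chart to the real chart**: `πs (t+1) (ℓs t) = j (k+t)`, along W5a's recursion formulas.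
[OURS · bookkeeping] -/
theorem πs_succ_apply_ℓs {la mu : Fin 4} {j : ℕ → Fin 4} {b : ℕ → Fin 4 → K} {k : ℕ}
    {πs : ℕ → Equiv.Perm (Fin 4)} {ℓs : ℕ → Fin 4}
    (hℓs : ∀ t, ℓs t = if j (k + t) = πs t la then la else if j (k + t) = πs t mu then mu
      else if b (k + t) (πs t la) ≠ 0 then la else mu)
    (hπs : ∀ t, πs (t + 1) = if j (k + t) = πs t la ∨ j (k + t) = πs t mu then πs t
      else (Equiv.swap (ℓs t) ((πs t).symm (j (k + t)))).trans (πs t)) (t : ℕ) :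
    πs (t + 1) (ℓs t) = j (k + t) := by
  rw [hπs t]
  by_cases h1 : j (k + t) = πs t la
  · rw [if_pos (Or.inl h1), hℓs t, if_pos h1, h1]
  · by_cases h2 : j (k + t) = πs t mu
    · rw [if_pos (Or.inr h2), hℓs t, if_neg h1, if_pos h2, h2]
    · rw [if_neg (not_or.mpr ⟨h1, h2⟩), Equiv.trans_apply, Equiv.swap_apply_left, Equiv.apply_symm_apply]

/-- The virtual chart is a slot letter. [OURS · bookkeeping] -/
theorem ℓs_eq_or {la mu : Fin 4} {j : ℕ → Fin 4} {b : ℕ → Fin 4 → K} {k : ℕ}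
    {πs : ℕ → Equiv.Perm (Fin 4)} {ℓs : ℕ → Fin 4}
    (hℓs : ∀ t, ℓs t = if j (k + t) = πs t la then la else if j (k + t) = πs t mu then mu
      else if b (k + t) (πs t la) ≠ 0 then la else mu) (t : ℕ) : ℓs t = la ∨ ℓs t = mu := by
  rw [hℓs t]
  split_ifs
  exacts [Or.inl rfl, Or.inr rfl, Or.inl rfl, Or.inr rfl]

/-- **A REAL SATELLITE STEP IS A VIRTUAL LETTER CHANGE** ((ℓ-sat) of res-dim4-p-3 g6's list): along W5a's recursion data, if the real step
`k + t + 1` is satellite to the step `k + t` (`j (k+t+1) ≠ j (k+t)`, `b (k+t+1) (j (k+t)) = 0`) then `ℓs (t+1) ≠ ℓs t` — given that a real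
step charting neither slot translates one of them (`hone`; in regime this is G1 `step_cases_of_weights_prime`, see the next lemma).
[OURS] [cite: Hauser2010, §§F–G] -/
theorem virtual_letter_change_of_satellite {la mu : Fin 4} (hlm : la ≠ mu) {j : ℕ → Fin 4} {b : ℕ → Fin 4 → K} {k : ℕ}
    {πs : ℕ → Equiv.Perm (Fin 4)} {ℓs : ℕ → Fin 4}
    (hℓs : ∀ t, ℓs t = if j (k + t) = πs t la then la else if j (k + t) = πs t mu then mu
      else if b (k + t) (πs t la) ≠ 0 then la else mu)
    (hπs : ∀ t, πs (t + 1) = if j (k + t) = πs t la ∨ j (k + t) = πs t mu then πs t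
      else (Equiv.swap (ℓs t) ((πs t).symm (j (k + t)))).trans (πs t)) {t : ℕ}
    (hone : j (k + (t + 1)) ≠ πs (t + 1) la → j (k + (t + 1)) ≠ πs (t + 1) mu →
      b (k + (t + 1)) (πs (t + 1) la) ≠ 0 ∨ b (k + (t + 1)) (πs (t + 1) mu) ≠ 0)
    (hsat : FreeTail.IsSatellite j b (k + t)) : ℓs (t + 1) ≠ ℓs t := by
  obtain ⟨hne, hb0⟩ := hsat
  have hkey := πs_succ_apply_ℓs hℓs hπs t
  have hkt : k + t + 1 = k + (t + 1) := by omega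
  rw [hkt] at hne hb0
  rw [← hkey] at hne hb0
  rcases ℓs_eq_or hℓs t with h | h <;> rw [h] at hne hb0 ⊢
  · -- the virtual chart was `λ`: the next one is `μ`
    rw [hℓs (t + 1), if_neg hne]
    by_cases h2 : j (k + (t + 1)) = πs (t + 1) mu
    · rw [if_pos h2]; exact hlm.symm
    · rw [if_neg h2, if_neg (not_not.mpr hb0)]; exact hlm.symm
  · -- the virtual chart was `μ`: the next one is `λ`
    rw [hℓs (t + 1)]
    by_cases h1 : j (k + (t + 1)) = πs (t + 1) la
    · rw [if_pos h1]; exact hlm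
    · rw [if_neg h1, if_neg hne]
      have hb : b (k + (t + 1)) (πs (t + 1) la) ≠ 0 := by
        rcases hone h1 hne with h' | h'
        · exact h'
        · exact absurd hb0 h'
      rw [if_pos hb]; exact hlm

/-- (ℓ-sat) in regime: `hone` from G1 `step_cases_of_weights_prime` (the real step `k + t + 1` keeps weights `≤ 1` of degree `2` from a state
of order `p + 1` with weights `e_{πs(t+1) λ} + e_{πs(t+1) μ}`). [OURS] [cite: Hauser2010, §§F–G] -/
theorem virtual_letter_change_of_satellite_of_regime (p : ℕ) {la mu u f : Fin 4} (hlm : la ≠ mu) (hlu : la ≠ u) (hlf : la ≠ f)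
    (hmu : mu ≠ u) (hmf : mu ≠ f) (huf : u ≠ f) {c : ℕ → State K} {j : ℕ → Fin 4} {b : ℕ → Fin 4 → K} {k : ℕ}
    {πs : ℕ → Equiv.Perm (Fin 4)} {ℓs : ℕ → Fin 4}
    (hℓs : ∀ t, ℓs t = if j (k + t) = πs t la then la else if j (k + t) = πs t mu then mu
      else if b (k + t) (πs t la) ≠ 0 then la else mu)
    (hπs : ∀ t, πs (t + 1) = if j (k + t) = πs t la ∨ j (k + t) = πs t mu then πs t
      else (Equiv.swap (ℓs t) ((πs t).symm (j (k + t)))).trans (πs t)) {t : ℕ}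
    (hrA : (c (k + (t + 1))).r = Finsupp.single (πs (t + 1) la) 1 + Finsupp.single (πs (t + 1) mu) 1)
    (hoA : ordZero (c (k + (t + 1))).F = ((p + 1 : ℕ) : ℕ∞))
    (hcs : c (k + (t + 2)) = CentreBlowup.step p Finset.univ (j (k + (t + 1))) (b (k + (t + 1))) (c (k + (t + 1))))
    (hw1 : ∀ i, (c (k + (t + 2))).r i ≤ 1) (hdeg : (c (k + (t + 2))).r.degree = 2)
    (hsat : FreeTail.IsSatellite j b (k + t)) : ℓs (t + 1) ≠ ℓs t := by
  set π := πs (t + 1) with hπ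
  have hπlm : π la ≠ π mu := fun h => hlm (π.injective h)
  have hπlu : π la ≠ π u := fun h => hlu (π.injective h)
  have hπlf : π la ≠ π f := fun h => hlf (π.injective h)
  have hπmu : π mu ≠ π u := fun h => hmu (π.injective h)
  have hπmf : π mu ≠ π f := fun h => hmf (π.injective h)
  have hπuf : π u ≠ π f := fun h => huf (π.injective h)
  rw [hcs] at hw1 hdeg
  refine virtual_letter_change_of_satellite hlm hℓs hπs (fun h1 h2 => ?_) hsat
  rcases step_cases_of_weights_prime p hπlm hπlu hπlf hπmu hπmf hπuf hrA hoA hw1 hdeg with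
    ⟨hjr, -, -⟩ | ⟨hjr, -, -⟩ | ⟨-, hrot⟩
  · exact absurd hjr h1
  · exact absurd hjr h2
  · rcases hrot with ⟨hbla, -, -⟩ | ⟨hbmu, -, -⟩
    · exact Or.inl hbla
    · exact Or.inr hbmu

/-! ## §2 The unpinned virtual chain -/

/-- **THE UNPINNED VIRTUAL CHAIN, every prime** ((I♭) of res-dim4-p-3 g6's list; module docstring §2). [OURS] [cite: Hauser2010, §§F–G]
[cite: CossartJannsenSaito2020, Thm. 3.14] -/
theorem exists_virtual_translated_chain_prime (p : ℕ) [Fact p.Prime] [CharP K p] {d : ℕ} (hdp : d + 1 = p) (hd2 : 2 ≤ d)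
    {la mu u f : Fin 4} (hlm : la ≠ mu) (hlu : la ≠ u) (hlf : la ≠ f) (hmu : mu ≠ u) (hmf : mu ≠ f) (huf : u ≠ f)
    {c : ℕ → State K} {j : ℕ → Fin 4} {b : ℕ → Fin 4 → K} (hw : FreeTail.IsWitnessedChain p c j b) {k Nc T : ℕ}
    (hisoR : ∀ t, t ≤ T + 1 → IsIsolated p (c (k + t)).F)
    (hcert : ∀ t, t ≤ T + 1 → originIdeal K ^ Nc ≤ singLocusIdeal p (c (k + t)).F ⊔ originIdeal K ^ (Nc + 1))
    (hoR : ∀ t, t ≤ T + 1 → ordZero (c (k + t)).F = ((d + 2 : ℕ) : ℕ∞))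
    (he3R : ∀ t, t ≤ T + 1 → Module.finrank K (ResCone.resVertex (c (k + t))) = 3)
    (hwtR : ∀ t, t ≤ T + 1 → (∀ i, (c (k + t)).r i ≤ 1) ∧ (c (k + t)).r.degree = 2)
    (hdivR : ∀ t, t ≤ T + 1 → ∀ e ∈ (c (k + t)).F.support, (c (k + t)).r ≤ e)
    {π₀ : Equiv.Perm (Fin 4)} {B₀ : State K} {M : ℕ} (hM : Nc + 2 * p + 2 + p * T ≤ M)
    (hrel0 : ∃ (θ e : Fin 4 → MvPolynomial (Fin 4) K) (U E : MvPolynomial (Fin 4) K),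
      θ (π₀ la) = X la * e la ∧ θ (π₀ mu) = X mu * e mu ∧ constantCoeff (e la) ≠ 0 ∧ constantCoeff (e mu) ≠ 0 ∧
      constantCoeff (θ (π₀ u)) = 0 ∧ constantCoeff (θ (π₀ f)) = 0 ∧
      coeff (Finsupp.single u 1) (θ (π₀ u)) * coeff (Finsupp.single f 1) (θ (π₀ f)) -
        coeff (Finsupp.single f 1) (θ (π₀ u)) * coeff (Finsupp.single u 1) (θ (π₀ f)) ≠ 0 ∧
      constantCoeff U ≠ 0 ∧ E ∈ originIdeal K ^ M ∧ B₀.F = deletePthPowers p (U ^ p * aeval θ (c k).F) + E)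
    (hrA0 : (c k).r = Finsupp.single (π₀ la) 1 + Finsupp.single (π₀ mu) 1)
    (hfr0 : ordZero B₀.F = ((d + 2 : ℕ) : ℕ∞) ∧ B₀.r = Finsupp.single la 1 + Finsupp.single mu 1 ∧
      (∀ e ∈ B₀.F.support, B₀.r ≤ e) ∧ (∃ a : K, a ≠ 0 ∧ ResCone.resForm B₀ = C a * X f ^ d) ∧
      (∀ e ∈ B₀.F.support, e.degree = d + 2 → e = Finsupp.single la 1 + Finsupp.single mu 1 + Finsupp.single u 0 + Finsupp.single f d) ∧
      (∀ e ∈ B₀.F.support, e f ≤ d - 1 → 2 ≤ e la ∧ 2 ≤ e mu) ∧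
      IsIsolated p B₀.F ∧ Module.finrank K (ResCone.resVertex B₀) = 3) :
    ∃ (πs : ℕ → Equiv.Perm (Fin 4)) (Bs : ℕ → State K) (ℓs : ℕ → Fin 4) (βs : ℕ → K), πs 0 = π₀ ∧ Bs 0 = B₀ ∧
      (∀ t, ℓs t = if j (k + t) = πs t la then la else if j (k + t) = πs t mu then mu
        else if b (k + t) (πs t la) ≠ 0 then la else mu) ∧
      (∀ t, πs (t + 1) = if j (k + t) = πs t la ∨ j (k + t) = πs t mu then πs t
        else (Equiv.swap (ℓs t) ((πs t).symm (j (k + t)))).trans (πs t)) ∧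
      (∀ t, t ≤ T → Bs (t + 1) = CentreBlowup.step p Finset.univ (ℓs t) (Function.update (0 : Fin 4 → K) u (βs t)) (Bs t)) ∧
      ∀ t, t ≤ T + 1 →
        (∃ (θ e : Fin 4 → MvPolynomial (Fin 4) K) (U E : MvPolynomial (Fin 4) K),
          θ (πs t la) = X la * e la ∧ θ (πs t mu) = X mu * e mu ∧ constantCoeff (e la) ≠ 0 ∧ constantCoeff (e mu) ≠ 0 ∧
          constantCoeff (θ (πs t u)) = 0 ∧ constantCoeff (θ (πs t f)) = 0 ∧
          coeff (Finsupp.single u 1) (θ (πs t u)) * coeff (Finsupp.single f 1) (θ (πs t f)) -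
            coeff (Finsupp.single f 1) (θ (πs t u)) * coeff (Finsupp.single u 1) (θ (πs t f)) ≠ 0 ∧
          constantCoeff U ≠ 0 ∧ E ∈ originIdeal K ^ (M - p * t) ∧
          (Bs t).F = deletePthPowers p (U ^ p * aeval θ (c (k + t)).F) + E) ∧
        (c (k + t)).r = Finsupp.single (πs t la) 1 + Finsupp.single (πs t mu) 1 ∧
        (ordZero (Bs t).F = ((d + 2 : ℕ) : ℕ∞) ∧ (Bs t).r = Finsupp.single la 1 + Finsupp.single mu 1 ∧
          (∀ e ∈ (Bs t).F.support, (Bs t).r ≤ e) ∧ (∃ a : K, a ≠ 0 ∧ ResCone.resForm (Bs t) = C a * X f ^ d) ∧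
          (∀ e ∈ (Bs t).F.support, e.degree = d + 2 →
            e = Finsupp.single la 1 + Finsupp.single mu 1 + Finsupp.single u 0 + Finsupp.single f d) ∧
          (∀ e ∈ (Bs t).F.support, e f ≤ d - 1 → 2 ≤ e la ∧ 2 ≤ e mu) ∧
          IsIsolated p (Bs t).F ∧ Module.finrank K (ResCone.resVertex (Bs t)) = 3) := by
  have hdp2 : d + 2 = p + 1 := by omega
  -- the recursion data `πs, ℓs` (total; the states of `exists_virtual_data_prime` are not used)
  obtain ⟨πs, -, ℓs, hπ0, -, -, hℓs, hπs⟩ := exists_virtual_data_prime p j b k la mu π₀ B₀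
  -- ONE translated virtual step from a framed virtual state related to the real state `c (k + n)`, `n ≤ T`
  have hone : ∀ n, n ≤ T → ∀ B : State K,
      (∃ (θ e : Fin 4 → MvPolynomial (Fin 4) K) (U E : MvPolynomial (Fin 4) K),
        θ (πs n la) = X la * e la ∧ θ (πs n mu) = X mu * e mu ∧ constantCoeff (e la) ≠ 0 ∧ constantCoeff (e mu) ≠ 0 ∧
        constantCoeff (θ (πs n u)) = 0 ∧ constantCoeff (θ (πs n f)) = 0 ∧
        coeff (Finsupp.single u 1) (θ (πs n u)) * coeff (Finsupp.single f 1) (θ (πs n f)) -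
          coeff (Finsupp.single f 1) (θ (πs n u)) * coeff (Finsupp.single u 1) (θ (πs n f)) ≠ 0 ∧
        constantCoeff U ≠ 0 ∧ E ∈ originIdeal K ^ (M - p * n) ∧
        B.F = deletePthPowers p (U ^ p * aeval θ (c (k + n)).F) + E) →
      (c (k + n)).r = Finsupp.single (πs n la) 1 + Finsupp.single (πs n mu) 1 →
      (ordZero B.F = ((d + 2 : ℕ) : ℕ∞) ∧ B.r = Finsupp.single la 1 + Finsupp.single mu 1 ∧
        (∀ e ∈ B.F.support, B.r ≤ e) ∧ (∃ a : K, a ≠ 0 ∧ ResCone.resForm B = C a * X f ^ d) ∧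
        (∀ e ∈ B.F.support, e.degree = d + 2 → e = Finsupp.single la 1 + Finsupp.single mu 1 + Finsupp.single u 0 + Finsupp.single f d) ∧
        (∀ e ∈ B.F.support, e f ≤ d - 1 → 2 ≤ e la ∧ 2 ≤ e mu) ∧
        IsIsolated p B.F ∧ Module.finrank K (ResCone.resVertex B) = 3) →
      ∃ β : K,
        (∃ (θ e : Fin 4 → MvPolynomial (Fin 4) K) (U E : MvPolynomial (Fin 4) K),
          θ (πs (n + 1) la) = X la * e la ∧ θ (πs (n + 1) mu) = X mu * e mu ∧ constantCoeff (e la) ≠ 0 ∧ constantCoeff (e mu) ≠ 0 ∧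
          constantCoeff (θ (πs (n + 1) u)) = 0 ∧ constantCoeff (θ (πs (n + 1) f)) = 0 ∧
          coeff (Finsupp.single u 1) (θ (πs (n + 1) u)) * coeff (Finsupp.single f 1) (θ (πs (n + 1) f)) -
            coeff (Finsupp.single f 1) (θ (πs (n + 1) u)) * coeff (Finsupp.single u 1) (θ (πs (n + 1) f)) ≠ 0 ∧
          constantCoeff U ≠ 0 ∧ E ∈ originIdeal K ^ (M - p * (n + 1)) ∧
          (CentreBlowup.step p Finset.univ (ℓs n) (Function.update (0 : Fin 4 → K) u β) B).F =
            deletePthPowers p (U ^ p * aeval θ (c (k + (n + 1))).F) + E) ∧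
        (c (k + (n + 1))).r = Finsupp.single (πs (n + 1) la) 1 + Finsupp.single (πs (n + 1) mu) 1 ∧
        (ordZero (CentreBlowup.step p Finset.univ (ℓs n) (Function.update (0 : Fin 4 → K) u β) B).F = ((d + 2 : ℕ) : ℕ∞) ∧
          (CentreBlowup.step p Finset.univ (ℓs n) (Function.update (0 : Fin 4 → K) u β) B).r = Finsupp.single la 1 + Finsupp.single mu 1 ∧
          (∀ e ∈ (CentreBlowup.step p Finset.univ (ℓs n) (Function.update (0 : Fin 4 → K) u β) B).F.support,
            (CentreBlowup.step p Finset.univ (ℓs n) (Function.update (0 : Fin 4 → K) u β) B).r ≤ e) ∧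
          (∃ a : K, a ≠ 0 ∧
            ResCone.resForm (CentreBlowup.step p Finset.univ (ℓs n) (Function.update (0 : Fin 4 → K) u β) B) = C a * X f ^ d) ∧
          (∀ e ∈ (CentreBlowup.step p Finset.univ (ℓs n) (Function.update (0 : Fin 4 → K) u β) B).F.support, e.degree = d + 2 →
            e = Finsupp.single la 1 + Finsupp.single mu 1 + Finsupp.single u 0 + Finsupp.single f d) ∧
          (∀ e ∈ (CentreBlowup.step p Finset.univ (ℓs n) (Function.update (0 : Fin 4 → K) u β) B).F.support,
            e f ≤ d - 1 → 2 ≤ e la ∧ 2 ≤ e mu) ∧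
          IsIsolated p (CentreBlowup.step p Finset.univ (ℓs n) (Function.update (0 : Fin 4 → K) u β) B).F ∧
          Module.finrank K (ResCone.resVertex (CentreBlowup.step p Finset.univ (ℓs n) (Function.update (0 : Fin 4 → K) u β) B)) = 3) := by
    intro n hn B hrel hrA hfr
    obtain ⟨hoB, hrB, hdivB, ⟨a, ha, hformB⟩, hstrB, hledB, -, -⟩ := hfr
    obtain ⟨-, hbj, -, -, hcs⟩ := hw (k + n)
    have hcs' : c (k + (n + 1)) = CentreBlowup.step p Finset.univ (j (k + n)) (b (k + n)) (c (k + n)) := hcs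
    have hpn : p * n + p = p * (n + 1) := (Nat.mul_succ p n).symm
    have hpnT : p * n ≤ p * T := Nat.mul_le_mul_left p hn
    have hoA1 : ordZero (c (k + n)).F = ((p + 1 : ℕ) : ℕ∞) := by rw [hoR n (by omega), hdp2]
    have hoB1 : ordZero B.F = ((p + 1 : ℕ) : ℕ∞) := by rw [hoB, hdp2]
    have hoA'1 : ordZero (c (k + (n + 1))).F = ((p + 1 : ℕ) : ℕ∞) := by rw [hoR (n + 1) (by omega), hdp2]
    obtain ⟨ℓ, π', b', hℓ, hℓeq, hπ'eq, hb'l, hb'm, hrel', hrA', ho', hr', hdiv', hiso', he3'⟩ :=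
      virtual_core_any_prime p hlm hlu hlf hmu hmf huf hrel hrA hoA1 hoB1 hrB hdivB hbj hcs' (hisoR (n + 1) (by omega))
        (hcert (n + 1) (by omega)) hoA'1 (he3R (n + 1) (by omega)) (hwtR (n + 1) (by omega)).1 (hwtR (n + 1) (by omega)).2
        (hdivR (n + 1) (by omega)) (by omega)
    rw [← hdp2] at ho'
    have hℓn : ℓs n = ℓ := by rw [hℓs n, hℓeq]
    have hπn : πs (n + 1) = π' := by rw [hπs n, hπ'eq, hℓn]
    -- (VT-f): the contact component vanishes; `b′ = β·e_u`
    have hb'f : b' f = 0 := by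
      rcases hℓ with rfl | rfl
      · have hin : initialForm B.F = monomial (Finsupp.single ℓ 1 + Finsupp.single mu 1 + Finsupp.single f d) a := by
          rw [← ResCone.monomial_mul_resForm hdivB, hformB, hrB, X_pow_eq_monomial, C_mul_monomial, mul_one, monomial_mul, one_mul]
        exact ResCone.cInf_translation_contact_eq_zero_prime p hdp hlm.symm hlf.symm hmf.symm hoB ha hin hb'l hb'm ho'
      · have hin : initialForm B.F = monomial (Finsupp.single ℓ 1 + Finsupp.single la 1 + Finsupp.single f d) a := by
          rw [← ResCone.monomial_mul_resForm hdivB, hformB, hrB, X_pow_eq_monomial, C_mul_monomial, mul_one, monomial_mul, one_mul,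
            add_comm (Finsupp.single la 1) (Finsupp.single ℓ 1)]
        exact ResCone.cInf_translation_contact_eq_zero_prime p hdp hlm hmf.symm hlf.symm hoB ha hin hb'm hb'l ho'
    set β := b' u with hβ
    have hb'eq : b' = Function.update (0 : Fin 4 → K) u β := eq_single_of_letters hlm hlu hlf hmu hmf huf hb'l hb'm hb'f
    rw [hb'eq] at hrel' ho' hr' hdiv' hiso' he3'
    -- TS: the translated child is framed
    have hframe : (∀ e ∈ (CentreBlowup.step p Finset.univ ℓ (Function.update (0 : Fin 4 → K) u β) B).F.support, e f ≤ d - 1 →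
          2 ≤ e la ∧ 2 ≤ e mu) ∧
        (∃ a : K, a ≠ 0 ∧ ResCone.resForm (CentreBlowup.step p Finset.univ ℓ (Function.update (0 : Fin 4 → K) u β) B) = C a * X f ^ d) ∧
        (∀ e ∈ (CentreBlowup.step p Finset.univ ℓ (Function.update (0 : Fin 4 → K) u β) B).F.support, e.degree = d + 2 →
          e = Finsupp.single la 1 + Finsupp.single mu 1 + Finsupp.single u 0 + Finsupp.single f d) := by
      rcases hℓ with rfl | rfl
      · obtain ⟨-, -, hled₁, hform₁, hstr₁⟩ :=
          ResCone.translated_child_frame_prime hlm hlu hlf hmu hmf huf p hdp hd2 hrB hdivB hoB hstrB hledB β ho' he3'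
        exact ⟨hled₁, hform₁, hstr₁⟩
      · have hrBs : B.r = Finsupp.single ℓ 1 + Finsupp.single la 1 := by rw [hrB, add_comm]
        have hstrBs : ∀ e ∈ B.F.support, e.degree = d + 2 →
            e = Finsupp.single ℓ 1 + Finsupp.single la 1 + Finsupp.single u 0 + Finsupp.single f d :=
          fun e he hdeg => (hstrB e he hdeg).trans (ResCone.cone_comm ℓ la u f d)
        have hledBs : ∀ e ∈ B.F.support, e f ≤ d - 1 → 2 ≤ e ℓ ∧ 2 ≤ e la := fun e he hf => (hledB e he hf).symm
        obtain ⟨-, -, hled₁, hform₁, hstr₁⟩ :=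
          ResCone.translated_child_frame_prime hlm.symm hmu hmf hlu hlf huf p hdp hd2 hrBs hdivB hoB hstrBs hledBs β ho' he3'
        exact ⟨fun e he hf => (hled₁ e he hf).symm, hform₁, fun e he hdeg => (hstr₁ e he hdeg).trans (ResCone.cone_comm la ℓ u f d)⟩
    obtain ⟨hled₁, hform₁, hstr₁⟩ := hframe
    have hM5 : M - p * n - p = M - p * (n + 1) := by omega
    rw [hM5] at hrel'
    rw [← hℓn] at hrel' ho' hr' hdiv' hiso' he3' hled₁ hform₁ hstr₁
    rw [← hπn] at hrel' hrA'
    exact ⟨β, hrel', hrA', ho', hr', hdiv', hform₁, hstr₁, hled₁, hiso', he3'⟩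
  -- extend-and-update induction on the number of steps
  have main : ∀ n, n ≤ T + 1 → ∃ (Bs : ℕ → State K) (βs : ℕ → K), Bs 0 = B₀ ∧
      (∀ t, t < n → Bs (t + 1) = CentreBlowup.step p Finset.univ (ℓs t) (Function.update (0 : Fin 4 → K) u (βs t)) (Bs t)) ∧
      ∀ t, t ≤ n →
        (∃ (θ e : Fin 4 → MvPolynomial (Fin 4) K) (U E : MvPolynomial (Fin 4) K),
          θ (πs t la) = X la * e la ∧ θ (πs t mu) = X mu * e mu ∧ constantCoeff (e la) ≠ 0 ∧ constantCoeff (e mu) ≠ 0 ∧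
          constantCoeff (θ (πs t u)) = 0 ∧ constantCoeff (θ (πs t f)) = 0 ∧
          coeff (Finsupp.single u 1) (θ (πs t u)) * coeff (Finsupp.single f 1) (θ (πs t f)) -
            coeff (Finsupp.single f 1) (θ (πs t u)) * coeff (Finsupp.single u 1) (θ (πs t f)) ≠ 0 ∧
          constantCoeff U ≠ 0 ∧ E ∈ originIdeal K ^ (M - p * t) ∧
          (Bs t).F = deletePthPowers p (U ^ p * aeval θ (c (k + t)).F) + E) ∧
        (c (k + t)).r = Finsupp.single (πs t la) 1 + Finsupp.single (πs t mu) 1 ∧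
        (ordZero (Bs t).F = ((d + 2 : ℕ) : ℕ∞) ∧ (Bs t).r = Finsupp.single la 1 + Finsupp.single mu 1 ∧
          (∀ e ∈ (Bs t).F.support, (Bs t).r ≤ e) ∧ (∃ a : K, a ≠ 0 ∧ ResCone.resForm (Bs t) = C a * X f ^ d) ∧
          (∀ e ∈ (Bs t).F.support, e.degree = d + 2 →
            e = Finsupp.single la 1 + Finsupp.single mu 1 + Finsupp.single u 0 + Finsupp.single f d) ∧
          (∀ e ∈ (Bs t).F.support, e f ≤ d - 1 → 2 ≤ e la ∧ 2 ≤ e mu) ∧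
          IsIsolated p (Bs t).F ∧ Module.finrank K (ResCone.resVertex (Bs t)) = 3) := by
    intro n
    induction n with
    | zero =>
      intro _
      refine ⟨fun _ => B₀, fun _ => 0, rfl, fun t ht => absurd ht (Nat.not_lt_zero t), fun t ht => ?_⟩
      obtain rfl : t = 0 := Nat.le_zero.mp ht
      simp only [Nat.mul_zero, Nat.sub_zero, Nat.add_zero]
      rw [hπ0]
      exact ⟨hrel0, hrA0, hfr0⟩
    | succ n ih =>
      intro hn
      obtain ⟨Bs, βs, hB0, hstepS, hpack⟩ := ih (by omega)
      obtain ⟨hrel, hrA, hfr⟩ := hpack n le_rfl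
      obtain ⟨β, hrel', hrA', hfr'⟩ := hone n (by omega) (Bs n) hrel hrA hfr
      refine ⟨Function.update Bs (n + 1) (CentreBlowup.step p Finset.univ (ℓs n) (Function.update (0 : Fin 4 → K) u β) (Bs n)),
        Function.update βs n β, ?_, fun t ht => ?_, fun t ht => ?_⟩
      · rw [Function.update_of_ne (Nat.succ_ne_zero n).symm, hB0]
      · rcases Nat.lt_succ_iff_lt_or_eq.mp ht with hlt | rfl
        · rw [Function.update_of_ne (by omega : t + 1 ≠ n + 1), Function.update_of_ne (by omega : t ≠ n + 1),
            Function.update_of_ne (by omega : t ≠ n)]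
          exact hstepS t hlt
        · rw [Function.update_self, Function.update_of_ne (by omega : t ≠ t + 1), Function.update_self]
      · rcases Nat.lt_or_ge t (n + 1) with hlt | hge
        · rw [Function.update_of_ne (by omega : t ≠ n + 1)]
          exact hpack t (by omega)
        · obtain rfl : t = n + 1 := le_antisymm ht hge
          rw [Function.update_self]
          exact ⟨hrel', hrA', hfr'⟩
  obtain ⟨Bs, βs, hB0, hstepS, hpack⟩ := main (T + 1) le_rfl
  exact ⟨πs, Bs, ℓs, βs, hπ0, hB0, hℓs, hπs, fun t ht => hstepS t (by omega), hpack⟩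

end SwapTransport

end Summit.ResolutionOfSingularities.ResolutionOfSingularities.Theorems.PIDim4

end
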